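import Mathlib.Analysis.InnerProductSpace.PiL2
import Mathlib.Data.Set.Card
import Literature.MathematicalPhysics.StatisticalMechanics.Theil2006PeriodicLatticeStructure
import HarnessLib

/-!
# Theil 2006, §3 p. 13: the periodic main estimate (44) from the finite main estimate (9)

Topic `Literature/MathematicalPhysics/StatisticalMechanics`; companion of
`Theil2006PeriodicLatticeStructure.lean` (`cellClasses`, `rowEnergy`, `shortBondSum`,
`defectClasses`, `mainEstimateRHS`; its `Theil2006_periodicGroundStates_upToRotation_of_mainEstimate`
consumes (44)) and `Theil2006PeriodicMinimumDistance.lean` (`relaxedPeriodicEnergy`, `cellEquiv`,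
`IsAdmissible.summable_periodic`). Everything here is PROVED (no `sorry`, no named fact; D-0026).

## Source, as printed (preprint p. 13, §3 Proof of Theorem 1.2)

"Theorem 2.1 can be easily generalized to the periodic setting […] we obtain that for all
`L`-periodic sets `X ⊂ A₂` and all `α < α₀` the ground state `y ∈ Y_L^per` of `E_L^per(X, ·)`
satisfies (44) `(1/#X̃) E^per_L(X, {y}) ≥ (1/C) Σ_{{x,x'}∈𝒮̃} (e_*({x,x'}) − 1) + ¼ #∂X̃ − 3 #X̃`
[…] The proof of (44) is omitted since it is identical to the proof of ineq. (9), the only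
difference being that all sets are replaced by the corresponding quotient sets."

Instead of re-running §2.3–§2.4 on quotient sets, this file DERIVES the periodic estimate from
the finite one by the thermodynamic-limit argument: restrict the periodic configuration to the
`n × n` block of period cells, apply (9) to this finite configuration (it satisfies (13)), and let
`n → ∞`. The interaction of the block with its complement is `o(n²)` by absolute summability of
the rows (`IsAdmissible.summable_periodic`) and periodicity; the short bonds and the defects of
the inner `(n − 2m₀)²` cells of the block are those of the periodic configuration.

## What is here

* `Theil2006.mainEstimate_periodic_of_finite` — **(44) from (9)**: if `V` satisfies (1)–(5) and
  the finite main estimate `E(z) ≥ −3N + ½Σ_𝒮(e_* + 1) + ¼#∂X` holds for every finite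
  configuration `z : X_N → ℝ²` with (13) (the conclusion of
  `Theil2006ShortRangeResummation.exists_mainLocalEstimate_finite`), then every `L`-periodic
  `X ⊂ A₂`, `y ∈ Y_L^per` with (13) on `X` satisfies
  `mainEstimateRHS 2 α V L X y ≤ relaxedPeriodicEnergy V L X y / 2`, i.e. (44) with the uniform
  constant `C = 2` (the hypothesis `h44`/`hmain` of `Theil2006DirichletLatticeStructure` and
  `Theil2006PeriodicLatticeStructure`).
-/

noncomputable section

open scoped BigOperators Topology
open Filter Set Metric

namespace Literature.MathematicalPhysics.StatisticalMechanics

namespace Theil2006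

/-! ### Finite bookkeeping: energies, short bonds and neighbourhoods of a relabelled configuration -/

section FiniteTransport

variable {α : ℝ} {V : ℝ → ℝ} {N : ℕ}

/-- `2E(z) = Σ_i Σ_{j ≠ i} V(|z_i − z_j|)`. [folklore] -/
private theorem two_mul_interactionEnergy_eq (V : ℝ → ℝ) (z : Fin N → Plane) :
    2 * interactionEnergy V z = ∑ i, ∑ j, if i = j then 0 else V (dist (z i) (z j)) := by
  have hswap : ∑ i : Fin N, ∑ j ∈ Finset.Ioi i, V (dist (z i) (z j)) =
      ∑ j : Fin N, ∑ i ∈ Finset.Iio j, V (dist (z i) (z j)) :=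
    Finset.sum_comm' fun i j => by simp
  have hrow : ∀ i : Fin N, ∑ j, (if i = j then 0 else V (dist (z i) (z j))) =
      ∑ j ∈ Finset.Ioi i, V (dist (z i) (z j)) + ∑ j ∈ Finset.Iio i, V (dist (z j) (z i)) := by
    intro i
    have hu : (Finset.univ : Finset (Fin N)) = insert i (Finset.Ioi i ∪ Finset.Iio i) := by
      ext j
      simp only [Finset.mem_univ, Finset.mem_insert, Finset.mem_union, Finset.mem_Ioi,
        Finset.mem_Iio, true_iff]
      rcases lt_trichotomy i j with h | h | h
      · exact Or.inr (Or.inl h)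
      · exact Or.inl h.symm
      · exact Or.inr (Or.inr h)
    have hdisj : Disjoint (Finset.Ioi i) (Finset.Iio i) :=
      Finset.disjoint_left.2 fun j h1 h2 => by
        rw [Finset.mem_Ioi] at h1; rw [Finset.mem_Iio] at h2; exact lt_asymm h1 h2
    have hni : i ∉ Finset.Ioi i ∪ Finset.Iio i := by simp
    rw [hu, Finset.sum_insert hni, if_pos rfl, zero_add, Finset.sum_union hdisj]
    congr 1
    · exact Finset.sum_congr rfl fun j hj => by
        rw [Finset.mem_Ioi] at hj; rw [if_neg (ne_of_lt hj)]
    · exact Finset.sum_congr rfl fun j hj => by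
        rw [Finset.mem_Iio] at hj; rw [if_neg (ne_of_gt hj), dist_comm]
  rw [Finset.sum_congr rfl fun i _ => hrow i, Finset.sum_add_distrib, ← hswap, interactionEnergy]
  ring

/-- `Σ_{{x,x'} ∈ 𝒮} f = ½ Σ_x Σ_{x' ≠ x, short} f` for a symmetric bond quantity. [folklore] -/
private theorem sum_shortRangePairs_eq_half_sum_sum (y : Fin N → Plane) (f : Fin N → Fin N → ℝ)
    (hf : ∀ i j, f i j = f j i) :
    ∑ p ∈ shortRangePairs α y, f p.1 p.2 =
      1 / 2 * ∑ i, ∑ j, if i ≠ j ∧ |dist (y i) (y j) - 1| ≤ α then f i j else 0 := by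
  classical
  have hS : ∑ p ∈ shortRangePairs α y, f p.1 p.2 =
      ∑ p ∈ (Finset.univ : Finset (Fin N × Fin N)).filter
        (fun p => p.1 < p.2 ∧ |dist (y p.1) (y p.2) - 1| ≤ α), f p.1 p.2 := rfl
  have hdouble : ∑ i, ∑ j, (if i ≠ j ∧ |dist (y i) (y j) - 1| ≤ α then f i j else 0) =
      ∑ p ∈ (Finset.univ : Finset (Fin N × Fin N)).filter
        (fun p => p.1 ≠ p.2 ∧ |dist (y p.1) (y p.2) - 1| ≤ α), f p.1 p.2 := by
    rw [Finset.sum_filter, ← Finset.univ_product_univ, Finset.sum_product]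
  have hsplit : (Finset.univ : Finset (Fin N × Fin N)).filter
      (fun p => p.1 ≠ p.2 ∧ |dist (y p.1) (y p.2) - 1| ≤ α) =
      (Finset.univ : Finset (Fin N × Fin N)).filter
        (fun p => p.1 < p.2 ∧ |dist (y p.1) (y p.2) - 1| ≤ α) ∪
      (Finset.univ : Finset (Fin N × Fin N)).filter
        (fun p => p.2 < p.1 ∧ |dist (y p.1) (y p.2) - 1| ≤ α) := by
    ext p
    simp only [Finset.mem_filter, Finset.mem_univ, true_and, Finset.mem_union]
    constructor
    · rintro ⟨hne, h⟩
      rcases lt_or_gt_of_ne hne with hlt | hlt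
      · exact Or.inl ⟨hlt, h⟩
      · exact Or.inr ⟨hlt, h⟩
    · rintro (⟨hlt, h⟩ | ⟨hlt, h⟩)
      · exact ⟨ne_of_lt hlt, h⟩
      · exact ⟨ne_of_gt hlt, h⟩
  have hdisj : Disjoint
      ((Finset.univ : Finset (Fin N × Fin N)).filter
        (fun p => p.1 < p.2 ∧ |dist (y p.1) (y p.2) - 1| ≤ α))
      ((Finset.univ : Finset (Fin N × Fin N)).filter
        (fun p => p.2 < p.1 ∧ |dist (y p.1) (y p.2) - 1| ≤ α)) :=
    Finset.disjoint_left.2 fun p h1 h2 => by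
      rw [Finset.mem_filter] at h1 h2
      exact lt_asymm h1.2.1 h2.2.1
  have hswap : ∑ p ∈ (Finset.univ : Finset (Fin N × Fin N)).filter
        (fun p => p.2 < p.1 ∧ |dist (y p.1) (y p.2) - 1| ≤ α), f p.1 p.2 =
      ∑ p ∈ (Finset.univ : Finset (Fin N × Fin N)).filter
        (fun p => p.1 < p.2 ∧ |dist (y p.1) (y p.2) - 1| ≤ α), f p.1 p.2 := by
    refine Finset.sum_bij' (fun p _ => p.swap) (fun p _ => p.swap) ?_ ?_ ?_ ?_ ?_
    · rintro ⟨u, v⟩ hp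
      simp only [Finset.mem_filter, Finset.mem_univ, true_and] at hp ⊢
      exact ⟨hp.1, by rw [dist_comm]; exact hp.2⟩
    · rintro ⟨u, v⟩ hp
      simp only [Finset.mem_filter, Finset.mem_univ, true_and] at hp ⊢
      exact ⟨hp.1, by rw [dist_comm]; exact hp.2⟩
    · rintro ⟨u, v⟩ _; rfl
    · rintro ⟨u, v⟩ _; rfl
    · rintro ⟨u, v⟩ _; exact hf u v
  rw [hS, hdouble, hsplit, Finset.sum_union hdisj, hswap]
  ring

variable (B : Finset (ℤ × ℤ))

/-- Relabelling a finite family of labels by `Fin #B`: double sums. [folklore] -/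
private theorem sum_sum_equivFin {M : Type*} [AddCommMonoid M] (e : ↥B ≃ Fin N)
    (G : ℤ × ℤ → ℤ × ℤ → M) :
    ∑ i, ∑ j, G (e.symm i) (e.symm j) = ∑ a ∈ B, ∑ b ∈ B, G a b := by
  have h1 : ∀ a : ↥B, ∑ j, G a (e.symm j) = ∑ b ∈ B, G a b := fun a => by
    rw [← Finset.sum_coe_sort B (fun b => G a b)]
    exact Fintype.sum_equiv e.symm _ _ fun _ => rfl
  calc ∑ i, ∑ j, G (e.symm i) (e.symm j) = ∑ a : ↥B, ∑ j, G a (e.symm j) :=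
        Fintype.sum_equiv e.symm _ _ fun _ => rfl
    _ = ∑ a : ↥B, ∑ b ∈ B, G a b := Finset.sum_congr rfl fun a _ => h1 a
    _ = ∑ a ∈ B, ∑ b ∈ B, G a b := Finset.sum_coe_sort B fun a => ∑ b ∈ B, G a b

/-- Relabelling: single sums. [folklore] -/
private theorem sum_equivFin {M : Type*} [AddCommMonoid M] (e : ↥B ≃ Fin N) (G : ℤ × ℤ → M) :
    ∑ i, G (e.symm i) = ∑ a ∈ B, G a := by
  rw [← Finset.sum_coe_sort B G]
  exact Fintype.sum_equiv e.symm _ _ fun _ => rfl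

/-- Relabelling: cardinalities of filtered sets. [folklore] -/
private theorem card_filter_equivFin (e : ↥B ≃ Fin N) (P : ℤ × ℤ → Prop) [DecidablePred P] :
    (Finset.univ.filter fun i => P (e.symm i)).card = (B.filter P).card := by
  rw [Finset.card_filter, Finset.card_filter]
  exact sum_equivFin B e (fun a => if P a then 1 else 0)

/-- The energy of the relabelled configuration `y|_B`. [folklore] -/
private theorem two_mul_interactionEnergy_relabel (y : ℤ × ℤ → Plane) (e : ↥B ≃ Fin N) :
    2 * interactionEnergy V (fun i => y (e.symm i)) =
      ∑ a ∈ B, ∑ b ∈ B, if a = b then 0 else V (dist (y a) (y b)) := by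
  rw [two_mul_interactionEnergy_eq]
  rw [← sum_sum_equivFin B e (fun a b => if a = b then 0 else V (dist (y a) (y b)))]
  refine Finset.sum_congr rfl fun i _ => Finset.sum_congr rfl fun j _ => ?_
  by_cases h : i = j
  · subst h; simp
  · have h' : ((e.symm i : ↥B) : ℤ × ℤ) ≠ (e.symm j : ↥B) := fun hc =>
      h (e.symm.injective (Subtype.ext hc))
    rw [if_neg h, if_neg h']

/-- The short-bond sum of the relabelled configuration, for a symmetric non-negative bond
quantity, dominates half the double sum over any subfamily of first end points. [folklore] -/
private theorem sum_shortRangePairs_relabel_ge (y : ℤ × ℤ → Plane) (e : ↥B ≃ Fin N) (f : ℝ → ℝ)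
    (hf : ∀ a ∈ B, ∀ b ∈ B, a ≠ b → |dist (y a) (y b) - 1| ≤ α → 0 ≤ f (dist (y a) (y b)))
    (I : Finset (ℤ × ℤ)) :
    1 / 2 * ∑ a ∈ B, ∑ b ∈ B,
        (if a ∈ I ∧ a ≠ b ∧ |dist (y a) (y b) - 1| ≤ α then f (dist (y a) (y b)) else 0) ≤
      ∑ p ∈ shortRangePairs α (fun i => y (e.symm i)), f (dist (y (e.symm p.1)) (y (e.symm p.2))) := by
  classical
  rw [sum_shortRangePairs_eq_half_sum_sum (fun i => y (e.symm i))
    (fun i j => f (dist (y (e.symm i)) (y (e.symm j)))) (fun i j => by rw [dist_comm])]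
  rw [← sum_sum_equivFin B e (fun a b =>
    if a ∈ I ∧ a ≠ b ∧ |dist (y a) (y b) - 1| ≤ α then f (dist (y a) (y b)) else 0)]
  refine mul_le_mul_of_nonneg_left (Finset.sum_le_sum fun i _ => Finset.sum_le_sum fun j _ => ?_)
    (by norm_num)
  have hne : (e.symm i : ↥B).1 ≠ (e.symm j : ↥B).1 ↔ i ≠ j :=
    ⟨fun h hij => h (by rw [hij]), fun h hc => h (e.symm.injective (Subtype.ext hc))⟩
  by_cases hI : ((e.symm i : ↥B) : ℤ × ℤ) ∈ I ∧ (e.symm i : ↥B).1 ≠ (e.symm j : ↥B).1 ∧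
      |dist (y (e.symm i)) (y (e.symm j)) - 1| ≤ α
  · rw [if_pos hI, if_pos ⟨hne.1 hI.2.1, hI.2.2⟩]
  · rw [if_neg hI]
    split_ifs with h
    · exact hf _ (e.symm i).2 _ (e.symm j).2 (hne.2 h.1) h.2
    · exact le_rfl

/-- The neighbourhood of a relabelled particle, counted in labels. [folklore] -/
private theorem card_nbhd_relabel (hα : α < 1) (y : ℤ × ℤ → Plane) (e : ↥B ≃ Fin N) (a : ↥B) :
    (nbhd α (fun i => y (e.symm i)) (e a)).card =
      (B.filter fun b => |dist (y a) (y b) - 1| ≤ α).card + 1 := by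
  classical
  rw [nbhd, Finset.card_insert_of_notMem]
  · rw [show (Finset.univ.filter fun j : Fin N =>
        |dist (y (e.symm (e a))) (y (e.symm j)) - 1| ≤ α) =
        Finset.univ.filter fun j : Fin N => |dist (y a) (y (e.symm j)) - 1| ≤ α by
      rw [e.symm_apply_apply]]
    rw [card_filter_equivFin B e (fun b => |dist (y a) (y b) - 1| ≤ α)]
  · rw [Finset.mem_filter, e.symm_apply_apply, dist_self]
    norm_num
    linarith

end FiniteTransport


/-! ### The block of `n × n` period cells -/

section Box

variable {α : ℝ} {V : ℝ → ℝ} {L : ℕ} {X : Set (ℤ × ℤ)} {y : ℤ × ℤ → Plane}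

/-- The period vectors `g ∈ [0, n)²` of the `n × n` block. [folklore] -/
def periodBox (n : ℕ) : Finset (ℤ × ℤ) := Finset.Ico (0 : ℤ) n ×ˢ Finset.Ico (0 : ℤ) n

/-- The period vectors `g ∈ [m, n − m)²` of depth `≥ m` in the block. [folklore] -/
def periodBoxDeep (n m : ℕ) : Finset (ℤ × ℤ) :=
  Finset.Ico (m : ℤ) ((n : ℤ) - m) ×ˢ Finset.Ico (m : ℤ) ((n : ℤ) - m)

/-- Membership in the block of period vectors. [folklore] -/
private theorem mem_periodBox {n : ℕ} {g : ℤ × ℤ} :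
    g ∈ periodBox n ↔ 0 ≤ g.1 ∧ g.1 < n ∧ 0 ≤ g.2 ∧ g.2 < n := by
  simp [periodBox, Finset.mem_product, Finset.mem_Ico, and_assoc]

/-- Membership in the deep period vectors. [folklore] -/
private theorem mem_periodBoxDeep {n m : ℕ} {g : ℤ × ℤ} :
    g ∈ periodBoxDeep n m ↔ (m : ℤ) ≤ g.1 ∧ g.1 < (n : ℤ) - m ∧ (m : ℤ) ≤ g.2 ∧ g.2 < (n : ℤ) - m := by
  simp [periodBoxDeep, Finset.mem_product, Finset.mem_Ico, and_assoc]

/-- Deep period vectors are in the block. [folklore] -/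
private theorem periodBoxDeep_subset (n m : ℕ) : periodBoxDeep n m ⊆ periodBox n := fun g hg => by
  rw [mem_periodBoxDeep] at hg
  rw [mem_periodBox]
  omega

/-- The block has `n²` period vectors. [folklore] -/
private theorem card_periodBox (n : ℕ) : (periodBox n).card = n ^ 2 := by
  simp [periodBox, Finset.card_product, sq]

/-- There are `(n − 2m)²` deep period vectors. [folklore] -/
private theorem card_periodBoxDeep {n m : ℕ} (h : 2 * m ≤ n) : (periodBoxDeep n m).card = (n - 2 * m) ^ 2 := by
  rw [periodBoxDeep, Finset.card_product, Int.card_Ico, sq]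
  have : ((n : ℤ) - m - m).toNat = n - 2 * m := by omega
  rw [this]

/-- The labels `x + L g`, `x ∈ X ∩ LU` a cell representative, `g ∈ [0,n)²`: the particles of `X`
in the block of `n × n` period cells. [cite: Theil2006, §3 (quotient sets by representatives, preprint p. 13)] -/
def labelBox (L : ℕ) (X : Set (ℤ × ℤ)) (n : ℕ) : Finset (ℤ × ℤ) :=
  (cellClasses L X ×ˢ periodBox n).image fun q => cellPoint q.1 + (L : ℤ) • q.2

/-- The inner labels of the block: period vectors of depth `≥ m`. [folklore] -/
def innerBox (L : ℕ) (X : Set (ℤ × ℤ)) (n m : ℕ) : Finset (ℤ × ℤ) :=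
  (cellClasses L X ×ˢ periodBoxDeep n m).image fun q => cellPoint q.1 + (L : ℤ) • q.2

/-- `(x, g) ↦ x + L g` is injective (`cellEquiv`). [folklore] -/
private theorem cellMap_injective (hL : 0 < L) :
    Function.Injective fun q : (Fin L × Fin L) × (ℤ × ℤ) => cellPoint q.1 + (L : ℤ) • q.2 :=
  fun _ _ h => (cellEquiv hL).injective h

/-- Sums over the block, representative by representative. [folklore] -/
private theorem sum_labelBox (hL : 0 < L) (n : ℕ) (φ : ℤ × ℤ → ℝ) :
    ∑ a ∈ labelBox L X n, φ a =
      ∑ c ∈ cellClasses L X, ∑ g ∈ periodBox n, φ (cellPoint c + (L : ℤ) • g) := by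
  rw [labelBox, Finset.sum_image fun _ _ _ _ h => cellMap_injective hL h, Finset.sum_product]

/-- Sums over the inner block, representative by representative. [folklore] -/
private theorem sum_innerBox (hL : 0 < L) (n m : ℕ) (φ : ℤ × ℤ → ℝ) :
    ∑ a ∈ innerBox L X n m, φ a =
      ∑ c ∈ cellClasses L X, ∑ g ∈ periodBoxDeep n m, φ (cellPoint c + (L : ℤ) • g) := by
  rw [innerBox, Finset.sum_image fun _ _ _ _ h => cellMap_injective hL h, Finset.sum_product]

/-- The block carries `n² #X̃` particles. [folklore] -/
private theorem card_labelBox (hL : 0 < L) (n : ℕ) :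
    (labelBox L X n).card = (cellClasses L X).card * n ^ 2 := by
  rw [labelBox, Finset.card_image_of_injective _ (cellMap_injective hL), Finset.card_product,
    card_periodBox]

/-- The inner block carries `(n − 2m)² #X̃` particles. [folklore] -/
private theorem card_innerBox (hL : 0 < L) {n m : ℕ} (h : 2 * m ≤ n) :
    (innerBox L X n m).card = (cellClasses L X).card * (n - 2 * m) ^ 2 := by
  rw [innerBox, Finset.card_image_of_injective _ (cellMap_injective hL), Finset.card_product,
    card_periodBoxDeep h]

/-- The inner block is part of the block. [folklore] -/
private theorem innerBox_subset (n m : ℕ) : innerBox L X n m ⊆ labelBox L X n := by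
  intro a ha
  rw [innerBox, Finset.mem_image] at ha
  obtain ⟨q, hq, rfl⟩ := ha
  rw [Finset.mem_product] at hq
  exact Finset.mem_image.2 ⟨q, Finset.mem_product.2 ⟨hq.1, periodBoxDeep_subset n m hq.2⟩, rfl⟩

/-- Membership in the block: `k ∈ X` with period vector in `[0,n)²`. [folklore] -/
private theorem mem_labelBox_iff (hL : 0 < L) (hX : IsPeriodicSet L X) {n : ℕ} {k : ℤ × ℤ} :
    k ∈ labelBox L X n ↔ k ∈ X ∧ ((cellEquiv hL).symm k).2 ∈ periodBox n := by
  constructor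
  · intro hk
    rw [labelBox, Finset.mem_image] at hk
    obtain ⟨⟨c, g⟩, hq, rfl⟩ := hk
    rw [Finset.mem_product] at hq
    refine ⟨hX _ (mem_cellClasses.1 hq.1) g, ?_⟩
    rw [show cellPoint (c, g).1 + (L : ℤ) • (c, g).2 = cellPoint c + (L : ℤ) • g from rfl,
      cellEquiv_symm_cellPoint_add]
    exact hq.2
  · rintro ⟨hkX, hg⟩
    rw [labelBox, Finset.mem_image]
    exact ⟨(cellEquiv hL).symm k, Finset.mem_product.2
      ⟨mem_cellClasses.2 ((hX.mem_iff_cellPoint_mem hL k).1 hkX), hg⟩,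
      cellEquiv_symm_apply_spec hL k⟩

/-- The block consists of particles of `X`. [folklore] -/
private theorem labelBox_subset (hL : 0 < L) (hX : IsPeriodicSet L X) (n : ℕ) :
    ↑(labelBox L X n) ⊆ X := fun _ hk => ((mem_labelBox_iff hL hX).1 hk).1

/-- The period vector of `k + L g` is that of `k` plus `g`. [folklore] -/
private theorem cellEquiv_symm_add_zsmul (hL : 0 < L) (k g : ℤ × ℤ) :
    (cellEquiv hL).symm (k + (L : ℤ) • g) =
      (((cellEquiv hL).symm k).1, ((cellEquiv hL).symm k).2 + g) := by
  have h := cellEquiv_symm_apply_spec hL k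
  conv_lhs => rw [← h, add_assoc, ← smul_add]
  exact cellEquiv_symm_cellPoint_add hL _ _

/-- **Uniform depth of the short bonds.** For a periodic configuration there is `m₀` such that
every particle of `X` equal or `𝒮`-bonded to a cell representative has period vector in
`(−m₀, m₀)²` (by `IsPeriodic.finite_shortRange`). [folklore] -/
private theorem exists_shortRange_depth (hL : 0 < L) (hy : IsPeriodic L y) (X : Set (ℤ × ℤ)) :
    ∃ m₀ : ℕ, ∀ (c : Fin L × Fin L) (x' : ℤ × ℤ),
      (x' = cellPoint c ∨ (x' ∈ X ∧ IsShortRange α y (cellPoint c) x')) →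
        |((cellEquiv hL).symm x').2.1| < m₀ ∧ |((cellEquiv hL).symm x').2.2| < m₀ := by
  classical
  have hfin : (⋃ c : Fin L × Fin L,
      ({cellPoint c} ∪ {x' | x' ∈ X ∧ IsShortRange α y (cellPoint c) x'})).Finite :=
    Set.finite_iUnion fun c => (Set.finite_singleton _).union (hy.finite_shortRange hL X _)
  set F := hfin.toFinset with hF
  refine ⟨F.sup (fun x' => max ((cellEquiv hL).symm x').2.1.natAbs ((cellEquiv hL).symm x').2.2.natAbs) + 1,
    fun c x' hx' => ?_⟩
  have hmem : x' ∈ F := by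
    rw [hF, Set.Finite.mem_toFinset, Set.mem_iUnion]
    refine ⟨c, ?_⟩
    rcases hx' with h | h
    · exact Or.inl h
    · exact Or.inr h
  have hle := Finset.le_sup (f := fun x' => max ((cellEquiv hL).symm x').2.1.natAbs
    ((cellEquiv hL).symm x').2.2.natAbs) hmem
  have h1 := le_of_max_le_left hle
  have h2 := le_of_max_le_right hle
  constructor
  · rw [Int.abs_eq_natAbs]; exact_mod_cast Nat.lt_succ_of_le h1
  · rw [Int.abs_eq_natAbs]; exact_mod_cast Nat.lt_succ_of_le h2

/-- Particles equal or `𝒮`-bonded to an inner particle of the block lie in the block.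
[folklore] -/
private theorem mem_labelBox_of_inner (hL : 0 < L) (hX : IsPeriodicSet L X) (hy : IsPeriodic L y)
    {m₀ : ℕ} (hm₀ : ∀ (c : Fin L × Fin L) (x' : ℤ × ℤ),
      (x' = cellPoint c ∨ (x' ∈ X ∧ IsShortRange α y (cellPoint c) x')) →
        |((cellEquiv hL).symm x').2.1| < m₀ ∧ |((cellEquiv hL).symm x').2.2| < m₀)
    {n : ℕ} {c : Fin L × Fin L} (hc : c ∈ cellClasses L X) {g : ℤ × ℤ}
    (hg : g ∈ periodBoxDeep n m₀) {x' : ℤ × ℤ}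
    (hx' : x' = cellPoint c + (L : ℤ) • g ∨ (x' ∈ X ∧ IsShortRange α y (cellPoint c + (L : ℤ) • g) x')) :
    x' ∈ labelBox L X n := by
  set x'' := x' - (L : ℤ) • g with hx''
  have hx'eq : x' = x'' + (L : ℤ) • g := by rw [hx'']; abel
  have hx''prop : x'' = cellPoint c ∨ (x'' ∈ X ∧ IsShortRange α y (cellPoint c) x'') := by
    rcases hx' with h | ⟨hX', hs⟩
    · left; rw [hx'', h]; abel
    · right
      refine ⟨?_, ?_⟩
      · have := (hX.add_zsmul_mem_iff x'' g).1 (by rw [← hx'eq]; exact hX')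
        exact this
      · rw [hx'eq] at hs
        exact (hy.isShortRange_add_zsmul_iff _ _ _).1 hs
  have hx''X : x'' ∈ X := by
    rcases hx''prop with h | h
    · rw [h]; exact mem_cellClasses.1 hc
    · exact h.1
  obtain ⟨h1, h2⟩ := hm₀ c x'' hx''prop
  rw [mem_labelBox_iff hL hX, hx'eq, cellEquiv_symm_add_zsmul, mem_periodBox]
  refine ⟨hX _ hx''X g, ?_⟩
  rw [mem_periodBoxDeep] at hg
  simp only [Prod.fst_add, Prod.snd_add]
  rw [abs_lt] at h1 h2
  omega

open scoped Classical in
/-- For an inner particle `a` of the block, the `𝒮`-neighbours of `a` in `X` are exactly the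
`𝒮`-neighbours of `a` in the block. [folklore] -/
private theorem shortRange_set_eq_filter (hL : 0 < L) (hX : IsPeriodicSet L X) (hy : IsPeriodic L y)
    {m₀ : ℕ} (hm₀ : ∀ (c : Fin L × Fin L) (x' : ℤ × ℤ),
      (x' = cellPoint c ∨ (x' ∈ X ∧ IsShortRange α y (cellPoint c) x')) →
        |((cellEquiv hL).symm x').2.1| < m₀ ∧ |((cellEquiv hL).symm x').2.2| < m₀)
    {n : ℕ} {c : Fin L × Fin L} (hc : c ∈ cellClasses L X) {g : ℤ × ℤ}
    (hg : g ∈ periodBoxDeep n m₀) :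
    {x' | x' ∈ X ∧ IsShortRange α y (cellPoint c + (L : ℤ) • g) x'} =
      ↑((labelBox L X n).filter fun b => IsShortRange α y (cellPoint c + (L : ℤ) • g) b) := by
  ext x'
  rw [Set.mem_setOf_eq, Finset.mem_coe, Finset.mem_filter]
  constructor
  · rintro ⟨hX', hs⟩
    exact ⟨mem_labelBox_of_inner hL hX hy hm₀ hc hg (Or.inr ⟨hX', hs⟩), hs⟩
  · rintro ⟨hb, hs⟩
    exact ⟨labelBox_subset hL hX n hb, hs⟩

end Box

/-! ### Rows, the block energy and the tails -/

section Rows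

variable {α : ℝ} {V : ℝ → ℝ} {L : ℕ} {X : Set (ℤ × ℤ)} {y : ℤ × ℤ → Plane}

/-- A row of the periodic energy as a sum over all labels with an indicator. [folklore] -/
private theorem rowEnergy_eq_tsum_indicator (a : ℤ × ℤ) :
    rowEnergy V X y a = ∑' k', (X \ {a}).indicator (fun k' => V (dist (y a) (y k'))) k' := by
  have hset : (X \ {a}) = {k' : ℤ × ℤ | k' ∈ X ∧ k' ≠ a} := by
    ext k'; simp
  rw [hset, ← tsum_subtype]
  rfl

/-- `E_L^per(X,{y}) = Σ_{x ∈ X ∩ LU} row(x)`. [cite: Theil2006, §3 (preprint p. 13)] -/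
theorem relaxedPeriodicEnergy_eq_sum_cellClasses (V : ℝ → ℝ) (L : ℕ) (X : Set (ℤ × ℤ))
    (y : ℤ × ℤ → Plane) :
    relaxedPeriodicEnergy V L X y = ∑ c ∈ cellClasses L X, rowEnergy V X y (cellPoint c) := by
  classical
  rw [relaxedPeriodicEnergy_eq_sum_rowEnergy, cellClasses, Finset.sum_filter]
  refine Finset.sum_congr rfl fun c _ => ?_
  by_cases h : cellPoint c ∈ X
  · rw [Set.indicator_of_mem h, if_pos h]
  · rw [Set.indicator_of_notMem h, if_neg h]

/-- The rows of the block add up to `n²` periodic energies. [cite: Theil2006, §3 (preprint p. 13)] -/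
theorem sum_labelBox_rowEnergy (hL : 0 < L) (hX : IsPeriodicSet L X) (hy : IsPeriodic L y)
    (n : ℕ) :
    ∑ a ∈ labelBox L X n, rowEnergy V X y a = (n : ℝ) ^ 2 * relaxedPeriodicEnergy V L X y := by
  rw [sum_labelBox hL, relaxedPeriodicEnergy_eq_sum_cellClasses, Finset.mul_sum]
  refine Finset.sum_congr rfl fun c _ => ?_
  rw [Finset.sum_congr rfl fun g _ => hy.rowEnergy_add_zsmul hX (V := V) (cellPoint c) g,
    Finset.sum_const, card_periodBox, nsmul_eq_mul]
  push_cast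
  ring

/-- The absolute tail of the row of `a` outside a set `S` of labels:
`T(a, S) = Σ_{x' ∈ X ∖ S} |V(|y(a) − y(x')|)|`. [folklore] -/
def absTail (V : ℝ → ℝ) (X : Set (ℤ × ℤ)) (y : ℤ × ℤ → Plane) (a : ℤ × ℤ) (S : Set (ℤ × ℤ)) : ℝ :=
  ∑' k', (X \ S).indicator (fun k' => |V (dist (y a) (y k'))|) k'

/-- The absolute rows are summable (`IsAdmissible.summable_periodic`). [folklore] -/
private theorem summable_abs_indicator (hV : IsAdmissible α V) (hL : 0 < L) (hy : IsPeriodic L y)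
    (a : ℤ × ℤ) (S : Set (ℤ × ℤ)) :
    Summable fun k' => S.indicator (fun k' => |V (dist (y a) (y k'))|) k' :=
  ((hV.summable_periodic hL hy (y a)).abs.indicator S)

/-- Tails are non-negative. [folklore] -/
private theorem absTail_nonneg (a : ℤ × ℤ) (S : Set (ℤ × ℤ)) : 0 ≤ absTail V X y a S :=
  tsum_nonneg fun _ => Set.indicator_nonneg (fun _ _ => abs_nonneg _) _

/-- The tail is antitone in the excluded set (only its trace on `X` matters). [folklore] -/
private theorem absTail_mono (hV : IsAdmissible α V) (hL : 0 < L) (hy : IsPeriodic L y) (a : ℤ × ℤ)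
    {S₁ S₂ : Set (ℤ × ℤ)} (h : X ∩ S₁ ⊆ S₂) : absTail V X y a S₂ ≤ absTail V X y a S₁ := by
  refine (summable_abs_indicator hV hL hy a _).tsum_le_tsum (fun k' => ?_)
    (summable_abs_indicator hV hL hy a _)
  by_cases h2 : k' ∈ X \ S₂
  · have h1 : k' ∈ X \ S₁ := ⟨h2.1, fun hS => h2.2 (h ⟨h2.1, hS⟩)⟩
    rw [Set.indicator_of_mem h2, Set.indicator_of_mem h1]
  · rw [Set.indicator_of_notMem h2]
    exact Set.indicator_nonneg (fun _ _ => abs_nonneg _) _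

/-- **The block energy versus the periodic energy**: for the block `B` of `n × n` cells,
`Σ_{a ∈ B} Σ_{b ∈ B, b ≠ a} e({a,b}) ≤ n² E_L^per(X,{y}) + Σ_{a ∈ B} T(a, B)`.
[cite: Theil2006, §3 (preprint p. 13); our lemma] -/
theorem sum_sum_labelBox_le (hV : IsAdmissible α V) (hL : 0 < L) (hX : IsPeriodicSet L X)
    (hy : IsPeriodic L y) (n : ℕ) :
    ∑ a ∈ labelBox L X n, ∑ b ∈ labelBox L X n, (if a = b then 0 else V (dist (y a) (y b))) ≤
      (n : ℝ) ^ 2 * relaxedPeriodicEnergy V L X y +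
        ∑ a ∈ labelBox L X n, absTail V X y a ↑(labelBox L X n) := by
  classical
  rw [← sum_labelBox_rowEnergy hL hX hy n, ← Finset.sum_add_distrib]
  refine Finset.sum_le_sum fun a ha => ?_
  have haX : a ∈ X := labelBox_subset hL hX n ha
  have hsumm : Summable fun k' => (X \ {a}).indicator (fun k' => V (dist (y a) (y k'))) k' :=
    (hV.summable_periodic hL hy (y a)).indicator _
  rw [rowEnergy_eq_tsum_indicator, ← hsumm.sum_add_tsum_compl (s := labelBox L X n)]
  have hfin : ∑ b ∈ labelBox L X n, (X \ {a}).indicator (fun k' => V (dist (y a) (y k'))) b =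
      ∑ b ∈ labelBox L X n, (if a = b then 0 else V (dist (y a) (y b))) := by
    refine Finset.sum_congr rfl fun b hb => ?_
    by_cases hab : a = b
    · subst hab
      rw [if_pos rfl, Set.indicator_of_notMem (fun h => h.2 rfl)]
    · rw [if_neg hab, Set.indicator_of_mem (show b ∈ X \ {a} from
        ⟨labelBox_subset hL hX n hb, fun h => hab (Set.mem_singleton_iff.1 h).symm⟩)]
  rw [hfin]
  -- the tail is at least `−T(a, B)`
  have htail : -absTail V X y a ↑(labelBox L X n) ≤
      ∑' k' : ↥((↑(labelBox L X n) : Set (ℤ × ℤ))ᶜ),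
        (X \ {a}).indicator (fun k' => V (dist (y a) (y k'))) k' := by
    rw [absTail]
    have e : ∑' k', (X \ ↑(labelBox L X n)).indicator (fun k' => |V (dist (y a) (y k'))|) k' =
        ∑' k' : ↥((↑(labelBox L X n) : Set (ℤ × ℤ))ᶜ),
          X.indicator (fun k' => |V (dist (y a) (y k'))|) k' := by
      rw [tsum_subtype ((↑(labelBox L X n) : Set (ℤ × ℤ))ᶜ), Set.indicator_indicator]
      congr 1
      ext k'
      congr 1
      ext j
      simp only [Set.mem_sdiff, Set.mem_inter_iff, Set.mem_compl_iff, Finset.mem_coe]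
      tauto
    rw [e, ← tsum_neg]
    refine Summable.tsum_le_tsum (fun k' => ?_) ((summable_abs_indicator hV hL hy a X).subtype _).neg
      (hsumm.subtype _)
    by_cases hk : (k' : ℤ × ℤ) ∈ X \ {a}
    · rw [Set.indicator_of_mem hk, Set.indicator_of_mem hk.1]
      exact neg_abs_le _
    · rw [Set.indicator_of_notMem hk]
      have : 0 ≤ X.indicator (fun k' => |V (dist (y a) (y k'))|) (k' : ℤ × ℤ) :=
        Set.indicator_nonneg (fun _ _ => abs_nonneg _) _
      linarith
  linarith

/-- **Shifting a tail along the period lattice**: `T(x + Lg, S) = T(x, S − Lg)`.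
[cite: Theil2006, §3 (preprint p. 13); our lemma] -/
theorem absTail_add_zsmul (hX : IsPeriodicSet L X) (hy : IsPeriodic L y) (a g : ℤ × ℤ)
    (S : Set (ℤ × ℤ)) :
    absTail V X y (a + (L : ℤ) • g) S =
      absTail V X y a ((fun k => k + (L : ℤ) • g) ⁻¹' S) := by
  rw [absTail, absTail, ← (Equiv.addRight ((L : ℤ) • g)).tsum_eq]
  refine tsum_congr fun k'' => ?_
  rw [Equiv.coe_addRight]
  by_cases hk : k'' ∈ X \ ((fun k => k + (L : ℤ) • g) ⁻¹' S)
  · have hk' : k'' + (L : ℤ) • g ∈ X \ S := ⟨hX _ hk.1 g, hk.2⟩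
    rw [Set.indicator_of_mem hk', Set.indicator_of_mem hk, hy.dist_add_zsmul]
  · have hk' : k'' + (L : ℤ) • g ∉ X \ S := fun h =>
      hk ⟨(hX.add_zsmul_mem_iff k'' g).1 h.1, h.2⟩
    rw [Set.indicator_of_notMem hk', Set.indicator_of_notMem hk]

/-- **The tails are uniformly small far inside**: for every `ε > 0` there is a finite set `s₀`
of labels with `T(x, s₀) ≤ ε` for every cell representative `x`.
(`tendsto_tsum_compl_atTop_zero`). [folklore] -/
private theorem exists_finset_absTail_le (V : ℝ → ℝ) (X : Set (ℤ × ℤ)) (y : ℤ × ℤ → Plane)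
    {ε : ℝ} (hε : 0 < ε) :
    ∃ s₀ : Finset (ℤ × ℤ), ∀ c : Fin L × Fin L, absTail V X y (cellPoint c) ↑s₀ ≤ ε := by
  classical
  have hc : ∀ c : Fin L × Fin L, ∃ s : Finset (ℤ × ℤ), ∀ s' : Finset (ℤ × ℤ), s ⊆ s' →
      absTail V X y (cellPoint c) ↑s' ≤ ε := by
    intro c
    have ht := tendsto_tsum_compl_atTop_zero
      (fun k' => X.indicator (fun k' => |V (dist (y (cellPoint c)) (y k'))|) k')
    obtain ⟨s, hs⟩ := Filter.eventually_atTop.1 (ht.eventually (gt_mem_nhds hε))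
    refine ⟨s, fun s' hs' => ?_⟩
    have h := hs s' hs'
    have e : absTail V X y (cellPoint c) ↑s' =
        ∑' k' : {x // x ∉ s'}, X.indicator (fun k' => |V (dist (y (cellPoint c)) (y k'))|) k' := by
      rw [absTail]
      rw [show (∑' k' : {x // x ∉ s'}, X.indicator (fun k' => |V (dist (y (cellPoint c)) (y k'))|) k') =
        ∑' k' : ↥((↑s' : Set (ℤ × ℤ))ᶜ), X.indicator (fun k' => |V (dist (y (cellPoint c)) (y k'))|) k'
        from rfl, tsum_subtype, Set.indicator_indicator]
      congr 1; ext k'; congr 1; ext j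
      simp only [Set.mem_sdiff, Set.mem_inter_iff, Set.mem_compl_iff, Finset.mem_coe]
      tauto
    rw [e]
    exact h.le
  choose s hs using hc
  refine ⟨Finset.univ.biUnion s, fun c => hs c _ (Finset.subset_biUnion_of_mem s (Finset.mem_univ c))⟩

/-- Every label of `X` in a fixed finite set, shifted by a deep period vector, lands in the block.
[folklore] -/
private theorem exists_depth_of_finset (hL : 0 < L) (hX : IsPeriodicSet L X) (s₀ : Finset (ℤ × ℤ)) :
    ∃ R₀ : ℕ, ∀ (n : ℕ) (g : ℤ × ℤ), g ∈ periodBoxDeep n R₀ →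
      X ∩ ↑s₀ ⊆ (fun k => k + (L : ℤ) • g) ⁻¹' ↑(labelBox L X n) := by
  classical
  refine ⟨s₀.sup (fun k => max ((cellEquiv hL).symm k).2.1.natAbs ((cellEquiv hL).symm k).2.2.natAbs) + 1,
    fun n g hg k hk => ?_⟩
  obtain ⟨hkX, hks⟩ := hk
  have hle := Finset.le_sup (f := fun k => max ((cellEquiv hL).symm k).2.1.natAbs
    ((cellEquiv hL).symm k).2.2.natAbs) (Finset.mem_coe.1 hks)
  have h1 : |((cellEquiv hL).symm k).2.1| ≤ (s₀.sup fun k => max ((cellEquiv hL).symm k).2.1.natAbs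
      ((cellEquiv hL).symm k).2.2.natAbs : ℕ) := by
    rw [Int.abs_eq_natAbs]; exact_mod_cast le_of_max_le_left hle
  have h2 : |((cellEquiv hL).symm k).2.2| ≤ (s₀.sup fun k => max ((cellEquiv hL).symm k).2.1.natAbs
      ((cellEquiv hL).symm k).2.2.natAbs : ℕ) := by
    rw [Int.abs_eq_natAbs]; exact_mod_cast le_of_max_le_right hle
  rw [Set.mem_preimage, Finset.mem_coe, mem_labelBox_iff hL hX, cellEquiv_symm_add_zsmul,
    mem_periodBox]
  refine ⟨hX _ hkX g, ?_⟩
  rw [mem_periodBoxDeep] at hg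
  simp only [Prod.fst_add, Prod.snd_add]
  rw [abs_le] at h1 h2
  push_cast at hg h1 h2
  omega

/-- **The total tail of the block is `o(n²)`**: for `ε > 0` there are `R₀` and `M` with
`Σ_{a ∈ B_n} T(a, B_n) ≤ #X̃ (n² ε + (n² − (n − 2R₀)²) M)` for all `n ≥ 2R₀`.
[cite: Theil2006, §3 (preprint p. 13); our lemma] -/
theorem sum_absTail_le (hV : IsAdmissible α V) (hL : 0 < L) (hX : IsPeriodicSet L X)
    (hy : IsPeriodic L y) {ε : ℝ} (hε : 0 < ε) :
    ∃ (R₀ : ℕ) (M : ℝ), 0 ≤ M ∧ ∀ n : ℕ, 2 * R₀ ≤ n →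
      ∑ a ∈ labelBox L X n, absTail V X y a ↑(labelBox L X n) ≤
        (cellClasses L X).card * ((n : ℝ) ^ 2 * ε + ((n : ℝ) ^ 2 - ((n : ℝ) - 2 * R₀) ^ 2) * M) := by
  classical
  obtain ⟨s₀, hs₀⟩ := exists_finset_absTail_le V X y (L := L) hε
  obtain ⟨R₀, hR₀⟩ := exists_depth_of_finset hL hX s₀
  -- `M` bounds every full row of absolute values
  set M : ℝ := ∑ c : Fin L × Fin L, absTail V X y (cellPoint c) ∅ with hM
  have hM0 : 0 ≤ M := Finset.sum_nonneg fun c _ => absTail_nonneg _ _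
  have hMc : ∀ c : Fin L × Fin L, ∀ S, absTail V X y (cellPoint c) S ≤ M := fun c S =>
    (absTail_mono hV hL hy _ (by simp)).trans
      (Finset.single_le_sum (f := fun c => absTail V X y (cellPoint c) ∅)
        (fun c _ => absTail_nonneg _ _) (Finset.mem_univ c))
  refine ⟨R₀, M, hM0, fun n hn => ?_⟩
  rw [sum_labelBox hL]
  have hper : ∀ c ∈ cellClasses L X, ∑ g ∈ periodBox n,
      absTail V X y (cellPoint c + (L : ℤ) • g) ↑(labelBox L X n) ≤
        (n : ℝ) ^ 2 * ε + ((n : ℝ) ^ 2 - ((n : ℝ) - 2 * R₀) ^ 2) * M := by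
    intro c _
    have hsplit := Finset.sum_filter_add_sum_filter_not (periodBox n)
      (fun g => g ∈ periodBoxDeep n R₀)
      (fun g => absTail V X y (cellPoint c + (L : ℤ) • g) ↑(labelBox L X n))
    have hdeep_eq : (periodBox n).filter (fun g => g ∈ periodBoxDeep n R₀) = periodBoxDeep n R₀ := by
      ext g
      simp only [Finset.mem_filter]
      exact ⟨fun h => h.2, fun h => ⟨periodBoxDeep_subset n R₀ h, h⟩⟩
    rw [hdeep_eq] at hsplit
    have h1 : ∑ g ∈ periodBoxDeep n R₀,
        absTail V X y (cellPoint c + (L : ℤ) • g) ↑(labelBox L X n) ≤ (n : ℝ) ^ 2 * ε := by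
      calc ∑ g ∈ periodBoxDeep n R₀, absTail V X y (cellPoint c + (L : ℤ) • g) ↑(labelBox L X n)
          ≤ ∑ g ∈ periodBoxDeep n R₀, ε := Finset.sum_le_sum fun g hg => by
            rw [absTail_add_zsmul hX hy]
            exact (absTail_mono hV hL hy _ (hR₀ n g hg)).trans (hs₀ c)
        _ = (periodBoxDeep n R₀).card * ε := by rw [Finset.sum_const, nsmul_eq_mul]
        _ ≤ (n : ℝ) ^ 2 * ε := by
            refine mul_le_mul_of_nonneg_right ?_ hε.le
            have := Finset.card_le_card (periodBoxDeep_subset n R₀)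
            rw [card_periodBox] at this
            exact_mod_cast this
    have h2 : ∑ g ∈ (periodBox n).filter (fun g => ¬g ∈ periodBoxDeep n R₀),
        absTail V X y (cellPoint c + (L : ℤ) • g) ↑(labelBox L X n) ≤
        ((n : ℝ) ^ 2 - ((n : ℝ) - 2 * R₀) ^ 2) * M := by
      calc ∑ g ∈ (periodBox n).filter (fun g => ¬g ∈ periodBoxDeep n R₀),
            absTail V X y (cellPoint c + (L : ℤ) • g) ↑(labelBox L X n)
          ≤ ∑ g ∈ (periodBox n).filter (fun g => ¬g ∈ periodBoxDeep n R₀), M :=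
            Finset.sum_le_sum fun g _ => by rw [absTail_add_zsmul hX hy]; exact hMc c _
        _ = ((periodBox n).filter (fun g => ¬g ∈ periodBoxDeep n R₀)).card * M := by
            rw [Finset.sum_const, nsmul_eq_mul]
        _ ≤ ((n : ℝ) ^ 2 - ((n : ℝ) - 2 * R₀) ^ 2) * M := by
            refine mul_le_mul_of_nonneg_right ?_ hM0
            have hcard : ((periodBox n).filter (fun g => ¬g ∈ periodBoxDeep n R₀)).card =
                n ^ 2 - (n - 2 * R₀) ^ 2 := by
              have h := Finset.card_filter_add_card_filter_not
                (s := periodBox n) (fun g => g ∈ periodBoxDeep n R₀)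
              rw [hdeep_eq, card_periodBoxDeep hn, card_periodBox] at h
              omega
            rw [hcard]
            have hle : (n - 2 * R₀) ^ 2 ≤ n ^ 2 := Nat.pow_le_pow_left (Nat.sub_le _ _) 2
            rw [Nat.cast_sub hle, Nat.cast_pow, Nat.cast_pow, Nat.cast_sub hn]
            push_cast
            exact le_rfl
    linarith
  calc ∑ c ∈ cellClasses L X, ∑ g ∈ periodBox n,
        absTail V X y (cellPoint c + (L : ℤ) • g) ↑(labelBox L X n)
      ≤ ∑ c ∈ cellClasses L X, ((n : ℝ) ^ 2 * ε + ((n : ℝ) ^ 2 - ((n : ℝ) - 2 * R₀) ^ 2) * M) :=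
        Finset.sum_le_sum hper
    _ = (cellClasses L X).card * ((n : ℝ) ^ 2 * ε + ((n : ℝ) ^ 2 - ((n : ℝ) - 2 * R₀) ^ 2) * M) := by
        rw [Finset.sum_const, nsmul_eq_mul]

end Rows


/-! ### The inner cells of the block: short bonds and defects are those of the periodic configuration -/

section Inner

variable {α : ℝ} {V : ℝ → ℝ} {L : ℕ} {X : Set (ℤ × ℤ)} {y : ℤ × ℤ → Plane}

/-- `𝒮`-neighbours transport along `L A₂`. [cite: Theil2006, §3 (preprint p. 13)] -/
theorem shortRange_set_add_zsmul (hX : IsPeriodicSet L X) (hy : IsPeriodic L y) (k g : ℤ × ℤ) :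
    {x' | x' ∈ X ∧ IsShortRange α y (k + (L : ℤ) • g) x'} =
      (fun x => x + (L : ℤ) • g) '' {x' | x' ∈ X ∧ IsShortRange α y k x'} := by
  ext x'
  simp only [Set.mem_setOf_eq, Set.mem_image]
  constructor
  · rintro ⟨hX', hs⟩
    refine ⟨x' - (L : ℤ) • g, ⟨?_, ?_⟩, by abel⟩
    · exact (hX.add_zsmul_mem_iff _ g).1 (by rwa [sub_add_cancel])
    · rw [← hy.isShortRange_add_zsmul_iff k (x' - (L : ℤ) • g) g, sub_add_cancel]
      exact hs
  · rintro ⟨x'', ⟨hX'', hs⟩, rfl⟩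
    exact ⟨hX _ hX'' g, (hy.isShortRange_add_zsmul_iff k x'' g).2 hs⟩

/-- The sum of a radial bond quantity over the `𝒮`-neighbours is `L A₂`-invariant.
[cite: Theil2006, §3 (preprint p. 13)] -/
theorem finsum_shortRange_add_zsmul (hX : IsPeriodicSet L X) (hy : IsPeriodic L y) (F : ℝ → ℝ)
    (k g : ℤ × ℤ) :
    ∑ᶠ x' ∈ {x' | x' ∈ X ∧ IsShortRange α y (k + (L : ℤ) • g) x'}, F (dist (y (k + (L : ℤ) • g)) (y x')) =
      ∑ᶠ x' ∈ {x' | x' ∈ X ∧ IsShortRange α y k x'}, F (dist (y k) (y x')) := by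
  rw [shortRange_set_add_zsmul hX hy k g,
    finsum_mem_image (fun a _ b _ h => add_right_cancel h)]
  exact finsum_mem_congr rfl fun x' _ => by rw [hy.dist_add_zsmul]

/-- `X ∩ 𝒩(a) = {a} ∪ {𝒮-neighbours of a in X}` for `a ∈ X`. [folklore] -/
private theorem inter_nbhdSet_eq {a : ℤ × ℤ} (haX : a ∈ X) :
    X ∩ nbhdSet α y a = insert a {x' | x' ∈ X ∧ IsShortRange α y a x'} := by
  ext x'
  simp only [Set.mem_inter_iff, mem_nbhdSet_iff, Set.mem_insert_iff, Set.mem_setOf_eq]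
  constructor
  · rintro ⟨hX', h | h⟩
    · exact Or.inl h
    · exact Or.inr ⟨hX', h⟩
  · rintro (rfl | ⟨hX', h⟩)
    · exact ⟨haX, Or.inl rfl⟩
    · exact ⟨hX', Or.inr h⟩

/-- `#(X ∩ 𝒩(x + Lg)) = #(X ∩ 𝒩(x))`. [cite: Theil2006, §3 (preprint p. 13)] -/
theorem ncard_inter_nbhdSet_add_zsmul (hX : IsPeriodicSet L X) (hy : IsPeriodic L y)
    (k g : ℤ × ℤ) :
    (X ∩ nbhdSet α y (k + (L : ℤ) • g)).ncard = (X ∩ nbhdSet α y k).ncard := by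
  have h : X ∩ nbhdSet α y (k + (L : ℤ) • g) =
      (fun x => x + (L : ℤ) • g) '' (X ∩ nbhdSet α y k) := by
    rw [hy.nbhdSet_add_zsmul, Set.image_inter (add_left_injective _)]
    congr 1
    ext x'
    constructor
    · intro hx'
      exact ⟨x' - (L : ℤ) • g, (hX.add_zsmul_mem_iff _ g).1 (by rwa [sub_add_cancel]),
        sub_add_cancel _ _⟩
    · rintro ⟨x'', hx'', rfl⟩
      exact hX _ hx'' g
  rw [h, Set.ncard_image_of_injective _ (add_left_injective _)]

end Inner

/-! ### (44) from (9) -/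

section Main

variable {α : ℝ} {V : ℝ → ℝ} {L : ℕ} {X : Set (ℤ × ℤ)} {y : ℤ × ℤ → Plane}

/-- **Theil 2006, (44) from (9) by the thermodynamic limit.** Let `V` satisfy (1)–(5) with
`0 < α < 1`, `L ≥ 1`, `X ⊂ A₂` `L`-periodic, `y ∈ Y_L^per` with (13) on `X`, and suppose the finite
main estimate `E(z) ≥ −3N + ½ Σ_{𝒮(z)} (e_* + 1) + ¼ #∂X(z)` holds for every finite configuration
`z : X_N → ℝ²` with (13) (Theorem 2.1 (9) in the form proved by
`Theil2006ShortRangeResummation.exists_mainLocalEstimate_finite`). Then (44) holds with `C = 2`: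
`½ E_L^per(X,{y}) ≥ ½ Σ_{𝒮̃} (e_* + 1) + ¼ #∂X̃ − 3 #X̃`, i.e.
`mainEstimateRHS 2 α V L X y ≤ relaxedPeriodicEnergy V L X y / 2`.
[cite: Theil2006, §3 (44) (preprint p. 13)] -/
theorem mainEstimate_periodic_of_finite (hV : IsAdmissible α V) (hα1 : α < 1) (hL : 0 < L) (hX : IsPeriodicSet L X) (hy : IsPeriodic L y)
    (h13 : ∀ k ∈ X, ∀ k' ∈ X, k ≠ k' → 1 - α < dist (y k) (y k'))
    (h9 : ∀ {N : ℕ} (z : Fin N → Plane), (∀ i j : Fin N, i ≠ j → 1 - α < dist (z i) (z j)) →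
      -3 * (N : ℝ) + 1 / 2 * ∑ p ∈ shortRangePairs α z,
          (renormalizedPotential V (dist (z p.1) (z p.2)) + 1) + 1 / 4 * (defects α z).card ≤
        interactionEnergy V z) :
    mainEstimateRHS 2 α V L X y ≤ relaxedPeriodicEnergy V L X y / 2 := by
  classical
  obtain ⟨m₀, hm₀⟩ := exists_shortRange_depth (α := α) hL hy X
  -- positivity of the short-bond terms
  have hf0 : ∀ a b : ℤ × ℤ, |dist (y a) (y b) - 1| ≤ α →
      0 ≤ renormalizedPotential V (dist (y a) (y b)) + 1 := by
    intro a b h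
    have hd : 0 < dist (y a) (y b) := by
      have := (abs_le.1 h).1; linarith
    linarith [hV.toIsNormalized.neg_one_le_renormalizedPotential hd]
  have hnotself : ∀ a : ℤ × ℤ, ¬|dist (y a) (y a) - 1| ≤ α := fun a h => by
    rw [dist_self] at h; norm_num at h; linarith
  -- ### the key finite inequality for the block of `n × n` cells
  have key : ∀ n : ℕ, 2 * m₀ ≤ n →
      -3 * ((cellClasses L X).card * (n : ℝ) ^ 2) +
        1 / 4 * ((n - 2 * m₀ : ℕ) : ℝ) ^ 2 *
          (shortBondSum α L X y (fun r => renormalizedPotential V r + 1) +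
            (defectClasses α L X y).card) ≤
      1 / 2 * ((n : ℝ) ^ 2 * relaxedPeriodicEnergy V L X y) +
        1 / 2 * ∑ a ∈ labelBox L X n, absTail V X y a ↑(labelBox L X n) := by
    intro n hn
    set B := labelBox L X n with hBdef
    set e := B.equivFin with he
    -- (13) for the block
    have h13z : ∀ i j : Fin B.card, i ≠ j →
        1 - α < dist (y (e.symm i)) (y (e.symm j)) := by
      intro i j hij
      have hne : ((e.symm i : ↥B) : ℤ × ℤ) ≠ (e.symm j : ↥B) := fun h =>
        hij (e.symm.injective (Subtype.ext h))
      exact h13 _ (labelBox_subset hL hX n (e.symm i).2) _ (labelBox_subset hL hX n (e.symm j).2) hne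
    have h9z := h9 (fun i => y (e.symm i)) h13z
    -- N
    have hN : (B.card : ℝ) = (cellClasses L X).card * (n : ℝ) ^ 2 := by
      rw [hBdef, card_labelBox hL]; push_cast; ring
    -- energy
    have hE : 2 * interactionEnergy V (fun i => y (e.symm i)) ≤
        (n : ℝ) ^ 2 * relaxedPeriodicEnergy V L X y + ∑ a ∈ B, absTail V X y a ↑B := by
      rw [two_mul_interactionEnergy_relabel B y e]
      exact sum_sum_labelBox_le hV hL hX hy n
    -- short bonds
    have hP : 1 / 2 * (((n - 2 * m₀ : ℕ) : ℝ) ^ 2 *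
        shortBondSum α L X y (fun r => renormalizedPotential V r + 1)) ≤
        ∑ p ∈ shortRangePairs α (fun i => y (e.symm i)),
          (renormalizedPotential V (dist (y (e.symm p.1)) (y (e.symm p.2))) + 1) := by
      have h := sum_shortRangePairs_relabel_ge (α := α) B y e
        (fun r => renormalizedPotential V r + 1) (fun a _ b _ _ hs => hf0 a b hs)
        (innerBox L X n m₀)
      refine le_trans (le_of_eq ?_) h
      congr 1
      -- evaluate the double sum
      have hinner : ∀ a ∈ innerBox L X n m₀,
          ∑ b ∈ B, (if a ∈ innerBox L X n m₀ ∧ a ≠ b ∧ |dist (y a) (y b) - 1| ≤ α then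
            renormalizedPotential V (dist (y a) (y b)) + 1 else 0) =
          ∑ᶠ x' ∈ {x' | x' ∈ X ∧ IsShortRange α y a x'},
            (renormalizedPotential V (dist (y a) (y x')) + 1) := by
        intro a ha
        obtain ⟨⟨c, g⟩, hq, rfl⟩ := Finset.mem_image.1 ha
        obtain ⟨hc, hg⟩ := Finset.mem_product.1 hq
        rw [show cellPoint (c, g).1 + (L : ℤ) • (c, g).2 = cellPoint c + (L : ℤ) • g from rfl] at ha ⊢
        rw [shortRange_set_eq_filter hL hX hy hm₀ hc hg, finsum_mem_coe_finset, Finset.sum_filter]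
        refine Finset.sum_congr rfl fun b _ => ?_
        by_cases hs : IsShortRange α y (cellPoint c + (L : ℤ) • g) b
        · have hne : cellPoint c + (L : ℤ) • g ≠ b := fun h => hnotself b (by rw [← h] at hs ⊢; exact hs)
          rw [if_pos ⟨ha, hne, hs⟩, if_pos hs]
        · rw [if_neg (fun h => hs h.2.2), if_neg hs]
      have houter : ∑ a ∈ B, ∑ b ∈ B,
          (if a ∈ innerBox L X n m₀ ∧ a ≠ b ∧ |dist (y a) (y b) - 1| ≤ α then
            renormalizedPotential V (dist (y a) (y b)) + 1 else 0) =
          ∑ a ∈ innerBox L X n m₀, ∑ᶠ x' ∈ {x' | x' ∈ X ∧ IsShortRange α y a x'},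
            (renormalizedPotential V (dist (y a) (y x')) + 1) := by
        rw [← Finset.sum_subset (innerBox_subset (L := L) (X := X) n m₀)]
        · exact Finset.sum_congr rfl hinner
        · intro a _ ha
          exact Finset.sum_eq_zero fun b _ => if_neg fun h => ha h.1
      rw [houter, sum_innerBox hL]
      rw [Finset.sum_congr rfl fun c _ => Finset.sum_congr rfl fun g _ =>
        finsum_shortRange_add_zsmul hX hy (fun r => renormalizedPotential V r + 1) (cellPoint c) g]
      simp only [Finset.sum_const, card_periodBoxDeep hn, nsmul_eq_mul, shortBondSum, Finset.mul_sum]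
      push_cast
      ring
    -- defects
    have hD : (((n - 2 * m₀ : ℕ) : ℝ) ^ 2 * (defectClasses α L X y).card) ≤
        ((defects α (fun i => y (e.symm i))).card : ℝ) := by
      -- the inner defects
      set ID := (innerBox L X n m₀).filter fun a => (X ∩ nbhdSet α y a).ncard ≠ 7 with hID
      have hIDB : ID ⊆ B := (Finset.filter_subset _ _).trans (innerBox_subset n m₀)
      have hsub : (Finset.univ.filter fun i : Fin B.card => ((e.symm i : ↥B) : ℤ × ℤ) ∈ ID) ⊆
          defects α (fun i => y (e.symm i)) := by
        intro i hi
        rw [Finset.mem_filter] at hi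
        obtain ⟨-, hi⟩ := hi
        rw [defects, Finset.mem_filter]
        refine ⟨Finset.mem_univ _, ?_⟩
        have hmem := hi
        rw [hID, Finset.mem_filter] at hmem
        obtain ⟨ha, hP⟩ := hmem
        obtain ⟨⟨c, g⟩, hq, hcg⟩ := Finset.mem_image.1 ha
        obtain ⟨hc, hg⟩ := Finset.mem_product.1 hq
        have hcard := card_nbhd_relabel B hα1 y e (e.symm i)
        rw [e.apply_symm_apply] at hcard
        rw [hcard]
        have hset : X ∩ nbhdSet α y (e.symm i : ↥B) =
            ↑(insert ((e.symm i : ↥B) : ℤ × ℤ) (B.filter fun b => |dist (y (e.symm i)) (y b) - 1| ≤ α)) := by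
          rw [inter_nbhdSet_eq (labelBox_subset hL hX n (e.symm i).2), Finset.coe_insert]
          congr 1
          rw [← hcg, show cellPoint (c, g).1 + (L : ℤ) • (c, g).2 = cellPoint c + (L : ℤ) • g from rfl,
            shortRange_set_eq_filter hL hX hy hm₀ hc hg]
          rfl
        rw [hset, Set.ncard_coe_finset, Finset.card_insert_of_notMem] at hP
        · exact hP
        · rw [Finset.mem_filter]; exact fun h => hnotself _ h.2
      have hcardID : (ID.card : ℝ) = ((n - 2 * m₀ : ℕ) : ℝ) ^ 2 * (defectClasses α L X y).card := by
        have hIDeq : ID = ((defectClasses α L X y) ×ˢ periodBoxDeep n m₀).image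
            fun q => cellPoint q.1 + (L : ℤ) • q.2 := by
          rw [hID, innerBox, Finset.filter_image]
          congr 1
          ext ⟨c, g⟩
          simp only [Finset.mem_filter, Finset.mem_product, mem_defectClasses, mem_cellClasses]
          rw [show cellPoint (c, g).1 + (L : ℤ) • (c, g).2 = cellPoint c + (L : ℤ) • g from rfl,
            ncard_inter_nbhdSet_add_zsmul hX hy]
          tauto
        rw [hIDeq, Finset.card_image_of_injective _ (cellMap_injective hL), Finset.card_product,
          card_periodBoxDeep hn]
        push_cast; ring
      have h1 := Finset.card_le_card hsub
      rw [card_filter_equivFin B e (fun a => a ∈ ID), Finset.filter_mem_eq_inter,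
        Finset.inter_eq_right.2 hIDB] at h1
      rw [← hcardID]
      exact_mod_cast h1
    -- combine
    rw [hN] at h9z
    have hDn : (0 : ℝ) ≤ ((n - 2 * m₀ : ℕ) : ℝ) ^ 2 := sq_nonneg _
    nlinarith [h9z, hE, hP, hD]
  -- ### the limit `n → ∞`
  have hcl0 : (0 : ℝ) ≤ (cellClasses L X).card := Nat.cast_nonneg _
  have hR : mainEstimateRHS 2 α V L X y =
      -3 * (cellClasses L X).card + 1 / 4 *
        (shortBondSum α L X y (fun r => renormalizedPotential V r + 1) +
          (defectClasses α L X y).card) := by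
    rw [mainEstimateRHS]; ring
  rw [hR]
  refine le_of_forall_pos_le_add fun δ hδ => ?_
  -- tails: `ε = δ / (#X̃ + 1)`
  have hε : 0 < δ / ((cellClasses L X).card + 1) := by positivity
  obtain ⟨R₀, M, hM0, hA⟩ := sum_absTail_le hV hL hX hy hε
  set S := shortBondSum α L X y (fun r => renormalizedPotential V r + 1) +
    (defectClasses α L X y).card with hS
  set Φ : ℕ → ℝ := fun n => -3 * (cellClasses L X).card +
    1 / 4 * (1 - 2 * (m₀ : ℝ) / n) ^ 2 * S with hΦ
  set Ψ : ℕ → ℝ := fun n => 1 / 2 * relaxedPeriodicEnergy V L X y +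
    1 / 2 * (cellClasses L X).card *
      (δ / ((cellClasses L X).card + 1) + (1 - (1 - 2 * (R₀ : ℝ) / n) ^ 2) * M) with hΨ
  have hle : ∀ᶠ n : ℕ in atTop, Φ n ≤ Ψ n := by
    rw [Filter.eventually_atTop]
    refine ⟨2 * m₀ + 2 * R₀ + 1, fun n hn => ?_⟩
    have hn1 : 2 * m₀ ≤ n := by omega
    have hn2 : 2 * R₀ ≤ n := by omega
    have hn0 : (0 : ℝ) < n := by exact_mod_cast (show 0 < n by omega)
    have k := key n hn1
    have a := hA n hn2
    have e1 : ((n - 2 * m₀ : ℕ) : ℝ) ^ 2 = (n : ℝ) ^ 2 * (1 - 2 * (m₀ : ℝ) / n) ^ 2 := by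
      rw [Nat.cast_sub hn1]; push_cast; field_simp
    have e2 : (n : ℝ) ^ 2 - ((n : ℝ) - 2 * R₀) ^ 2 =
        (n : ℝ) ^ 2 * (1 - (1 - 2 * (R₀ : ℝ) / n) ^ 2) := by
      field_simp
    rw [e1] at k
    rw [e2] at a
    have hmain : (n : ℝ) ^ 2 * Φ n ≤ (n : ℝ) ^ 2 * Ψ n := by
      simp only [hΦ, hΨ]
      nlinarith [k, a, sq_nonneg (n : ℝ)]
    exact le_of_mul_le_mul_left hmain (by positivity)
  have h0 : ∀ C : ℝ, Tendsto (fun n : ℕ => C / (n : ℝ)) atTop (𝓝 0) := fun C =>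
    tendsto_const_div_atTop_nhds_zero_nat C
  have hΦt : Tendsto Φ atTop (𝓝 (-3 * (cellClasses L X).card + 1 / 4 * (1 - 0) ^ 2 * S)) := by
    simp only [hΦ]
    have h := h0 (2 * (m₀ : ℝ))
    exact tendsto_const_nhds.add ((((tendsto_const_nhds.sub h).pow 2).const_mul _).mul_const _)
  have hΨt : Tendsto Ψ atTop (𝓝 (1 / 2 * relaxedPeriodicEnergy V L X y +
      1 / 2 * (cellClasses L X).card *
        (δ / ((cellClasses L X).card + 1) + (1 - (1 - 0) ^ 2) * M))) := by
    simp only [hΨ]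
    have h := h0 (2 * (R₀ : ℝ))
    exact tendsto_const_nhds.add
      ((tendsto_const_nhds.add
        ((tendsto_const_nhds.sub ((tendsto_const_nhds.sub h).pow 2)).mul_const _)).const_mul _)
  have hlim := le_of_tendsto_of_tendsto hΦt hΨt hle
  have hbound : 1 / 2 * (cellClasses L X).card * (δ / ((cellClasses L X).card + 1)) ≤ δ := by
    have h1 : ((cellClasses L X).card : ℝ) * (δ / ((cellClasses L X).card + 1)) ≤ δ := by
      rw [mul_div_assoc', div_le_iff₀ (by positivity)]
      nlinarith
    nlinarith
  simp only [sub_zero, one_pow, mul_one, sub_self, zero_mul, add_zero] at hlim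
  linarith

end Main

end Theil2006

end Literature.MathematicalPhysics.StatisticalMechanics

end
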